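import Summits.BirchSwinnertonDyer.BirchSwinnertonDyer.Theorems.TeichmullerTwistDescentKOfWeightExclusion
import Literature.RepresentationTheory.FiniteGroups.GL2ModularPrincipalSeriesBorelEigenfunctional
import HarnessLib

/-!
# Route `TeichmullerTwistDescent`, crux K `TwistedPeriodLatticeSaturation` (stmt-BirchSwinnertonDyer-25368):
# K from modularity, a NONZERO BOREL EIGENFUNCTIONAL on the full-level carrier (I1‴) and the Ash–Stevens weight
# exclusion (W‴) — the finite-index / socle clauses of the carrier functional are DISCHARGED

Cell `pub/bsd-wall` (D-0145 line route-BirchSwinnertonDyer-TeichmullerTwistDescent, OPEN rev 7), seat `bsd-line-ttd-p1`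
(prover 1/2, g25).  THEOREMS ONLY (no definition, no named fact, no `sorry`); `--supports stmt-BirchSwinnertonDyer-25368`.
BSD is not proved by this file; K is NOT proved by this file (it stays CONDITIONAL); nothing here closes an item.

WHAT.  After `KOfWeightExclusion` (g25: `hcar ⟸ I1″ ∧ W″`, `W″ ⟸ W‴`) the K-line's inputs were (I1″) «an equivariant
functional `Λ_Q(f_D) → L` with FINITE-INDEX image» and (W‴).  Here the finite-index clause is removed too: by Frobenius
reciprocity (`frobeniusCoord`, Literature `GL2ModularPrincipalSeriesBorelEigenfunctional`) an equivariant map from the carrier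
`C = H₁(Γ₀(M), ℤ_p[GL₂(𝔽_p)])` to the Bruhat model `L` of `Ind(ω̃^{p−1−b} ⊗ ω̃ᵇ)` is a `(B, ω̃^{p−1−b} ⊗ ω̃ᵇ)`-eigenfunctional
`λ : C → ℤ_p`; given a NONZERO such `λ` vanishing on `ker(spreadPeriod f_D)` — input (I1‴) `NonzeroBorelEigenfunctional` — and
(W‴) `NoEtaleWeightEigenQuotient`:

  **`integralTameTypeCarrierFunctional_of_borel_of_noEtaleWeightEigenQuotient : I1‴ → W‴ → IntegralTameTypeCarrierFunctional`**,
  **`twistedPeriodLatticeSaturation_of_borel_of_noEtaleWeightEigenQuotient (hnf) (hB) (hW) : K`** (route decl verbatim).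

PROOF.  Make `λ` primitive (`exists_eq_pow_smul_primitive`: `λ = pᶜλ₁`, some `λ₁(z₁) ∉ pℤ_p`; `λ₁` is still Borel-eigen and kills
`ker(spreadPeriod)`, hence is Hecke-eigen for `W`: `(T_q − a_q(W))z ∈ ker(spreadPeriod f_D)` by `spreadPeriod_heckeT`).  `Ψ₀ :=
frobeniusCoord λ₁ : C → L` is equivariant and Hecke-eigen with `Ψ₀(z)(1) = λ₁(z)`, so its image `Λ'` has NONZERO reduction.  If the
reduction image were not everything, it is the socle (`exists_surjective_symPowTwist_of_reduction_ne`) and `C ↠ Λ' ↠ Sym^{2b} ⊗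
(ω^{−b}∘det)` is an equivariant Hecke-eigen SURJECTION — zero by (W‴), absurd.  So the reduction image is everything and `Λ' = L`
by Nakayama (`toSubmodule_eq_top_of_forall_exists_coordReduce_eq_of_jacobson`, `p ∈ Jac(ℤ_p)`; no finite-index hypothesis).
`Ψ₀` descends to `Λ_Q(f_D) = C/ker(spreadPeriod)` (`liftQ ∘ quotKerEquivRange⁻¹`), is equivariant on spreads, onto `L`, and `L`
satisfies `ReductionSocleLe … (2b)` (`exists_injective_symPowTwist_of_toSubmodule_eq_top`).
STATE OF THE K-LINE: K ⟸ `exists_isNewformOf` ∧ (I1‴) ∧ (W‴) — one automorphic statement (a nonzero nebentypus-type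
eigenfunctional compatible with `f_W`: local Langlands / Carayol at `p` + Shapiro) and one mod-`p` Galois statement (no
`Sym^{2b} ⊗ det^{−b}` Hecke-eigen quotient of the carrier: Ash–Stevens + Deligne / Fontaine + the tame inertia shape).
[cite: SerreLinearRepresentations1977, §7.2 Prop. 21, §15.1] [cite: EmertonGeeSavitt2015, §3.2, Lemma 4.1.1]
[cite: AshStevens1986, §1 (1.2)–(1.4), Thm. 3.5] [cite: Shimura1971, §8.3 (8.3.2)]
-/

set_option autoImplicit false
-- single-conjunct summit: `Summit.BirchSwinnertonDyer.BirchSwinnertonDyer.…` repeats the name by design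
set_option linter.dupNamespace false

noncomputable section

open scoped Pointwise MatrixGroups TensorProduct

open Function CongruenceSubgroup
open Literature.RepresentationTheory.FiniteGroups Literature.RepresentationTheory.FiniteGroups.GL2
  Literature.NumberTheory.EllipticCurves.ModularForms
open Literature.NumberTheory.EllipticCurves (Kato2004.teichmullerChar)
open Literature.NumberTheory.ModularSymbols Literature.NumberTheory.ModularSymbols.FullLevel
open Literature.Algebra.Homology

namespace Summit.BirchSwinnertonDyer.BirchSwinnertonDyer.Theorems.TeichmullerTwistDescent

open WeierstrassCurve Literature.NumberTheory.EllipticCurves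

namespace KOfBorelEigenfunctional

/-- **`IntegralTameTypeCarrierFunctional` from a nonzero Borel eigenfunctional (I1‴) and the Ash–Stevens weight exclusion
(W‴).**  Make `λ` primitive (`exists_eq_pow_smul_primitive`); Frobenius reciprocity (`frobeniusCoord`) gives an equivariant
`Ψ₀ : C → L` with `Ψ₀(z)(1) = λ(z)`, Hecke-eigen because `λ` kills `ker(spreadPeriod f_D) ∋ (T_q − a_q)z`; its image has
nonzero reduction; if the reduction image were not everything it would be the socle and `C ↠ Sym^{2b} ⊗ (ω^{−b}∘det)`
equivariantly and Hecke-eigen — excluded by (W‴); so the reduction image is everything and `im Ψ₀ = L` by Nakayama (`p` in the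
Jacobson radical of `ℤ_p`, no finite-index hypothesis); `Ψ₀` descends to `Λ_Q(f_D) = C / ker(spreadPeriod)` and `L` satisfies
the reduction-socle condition.  BSD is not proved by this; K is not proved by this.
[cite: SerreLinearRepresentations1977, §7.2 Prop. 21, §15.1] [cite: EmertonGeeSavitt2015, §3.2, Lemma 4.1.1] -/
theorem integralTameTypeCarrierFunctional_of_borel_of_noEtaleWeightEigenQuotient
    (hB : NonzeroBorelEigenfunctional) (hW : NoEtaleWeightEigenQuotient) : IntegralTameTypeCarrierFunctional := by
  intro p M _ _ _ hpM _ _ W _ _ hN D hp11 hadd hirr hGo hV4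
  obtain ⟨hb, hb2, lam, hlam0, hlamB, hlamK⟩ := hB p M hpM W hN D hp11 hadd hirr hGo hV4
  letI : Algebra ℤ_[p] (ZMod p) := (PadicInt.toZMod (p := p)).toAlgebra
  -- coefficient data `ℤ_p → 𝔽_p`, `ϖ = p`
  have hsurj : Surjective (algebraMap ℤ_[p] (ZMod p)) := ZMod.ringHom_surjective _
  have hker : ∀ a : ℤ_[p], algebraMap ℤ_[p] (ZMod p) a = 0 ↔ (p : ℤ_[p]) ∣ a :=
    padicInt_algebraMap_eq_zero_iff p (padicInt_ker_eq_maximalIdeal p hsurj)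
  have halg : ∀ x : ℤ_[p], algebraMap ℤ_[p] (ZMod p) x = ZMod.castHom (dvd_refl p) (ZMod p) (PadicInt.toZMod x) := by
    intro x
    rw [ZMod.castHom_self, RingHom.id_apply]
    rfl
  have hreg : ∀ a : ℤ_[p], (p : ℤ_[p]) * a = 0 → a = 0 := padicInt_mul_eq_zero p
  have hsep : ∀ a : ℤ_[p], (∀ j : ℕ, (p : ℤ_[p]) ^ j ∣ a) → a = 0 := padicInt_eq_zero_of_forall_pow_dvd p
  have hjac : Ideal.span {(p : ℤ_[p])} ≤ (⊥ : Ideal ℤ_[p]).jacobson := by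
    rw [IsLocalRing.jacobson_eq_maximalIdeal ⊥ bot_ne_top, PadicInt.maximalIdeal_eq_span_p]
  set b := tameExponent p W with hbdef
  have hχne := TypeLatticeNoCaseOne.reduceChar_ne_of_exponents p halg hb hb2
  have hχ := TypeLatticeNoCaseOne.reduceChar_rel_of_exponents p halg (b := b) (by omega)
  -- a primitive eigenfunctional
  obtain ⟨c, lam₁, hlam₁, ⟨z₁, hz₁⟩, hlam₁K⟩ := exists_eq_pow_smul_primitive hreg hsep lam hlam0
  have hlam₁B : ∀ (β : borel (ZMod p)) (z : H1carrier ℤ_[p] p M),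
      lam₁ (H1carrierRep ℤ_[p] p M (β : GL (Fin 2) (ZMod p)) z) =
        (borelCharacter (ZMod p) (Kato2004.teichmullerChar p ^ (p - 1 - b)) (Kato2004.teichmullerChar p ^ b) β : ℤ_[p]) *
          lam₁ z := by
    intro β z
    have h := hlamB β z
    rw [hlam₁, hlam₁, mul_left_comm] at h
    exact mul_left_cancel₀ (pow_ne_zero c (NeZero.ne (p : ℤ_[p]))) h
  have hlam₁K' : ∀ z : H1carrier ℤ_[p] p M, spreadPeriod ℤ_[p] p M hpM D.f z = 0 → lam₁ z = 0 :=
    fun z hz => hlam₁K z (hlamK z hz)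
  -- `λ₁` is Hecke-eigen for `W`
  have hlam₁T : ∀ (q : ℕ) [NeZero q] (hq : q.Prime) (hqp : q ≠ p) (z : H1carrier ℤ_[p] p M),
      lam₁ (heckeT ℤ_[p] p M hq hqp z) = ((W.LFunction q : ℤ) : ℤ_[p]) * lam₁ z := by
    intro q _ hq hqp z
    have hcoef : (UpperHalfPlane.qExpansion 1 ⇑D.f).coeff q = ((W.LFunction q : ℤ) : ℂ) := D.isNewformOf.2 q
    have hT : HeckeRing0.toEnd (p ^ 2 * M) 2 (HeckeRing0.T (p ^ 2 * M) 2 q hq) D.f = ((W.LFunction q : ℤ) : ℂ) • D.f := by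
      rw [HeckeRing0.toEnd_T, D.isNewformOf.1.heckeT_eq_coeff_smul hq, hcoef]
    have h0 : spreadPeriod ℤ_[p] p M hpM D.f (heckeT ℤ_[p] p M hq hqp z - ((W.LFunction q : ℤ) : ℤ_[p]) • z) = 0 := by
      rw [map_sub, map_smul, spreadPeriod_heckeT ℤ_[p] p M hpM hq hqp hT z, sub_self]
    have := hlam₁K' _ h0
    rwa [map_sub, map_smul, smul_eq_mul, sub_eq_zero] at this
  -- Frobenius reciprocity: the equivariant map `Ψ₀ : C → L`
  let Ψ₀ : H1carrier ℤ_[p] p M →ₗ[ℤ_[p]] (Option (ZMod p) → ℤ_[p]) :=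
    frobeniusCoord (Kato2004.teichmullerChar p ^ (p - 1 - b)) (Kato2004.teichmullerChar p ^ b)
      (H1carrierRep ℤ_[p] p M) lam₁ hlam₁B
  have hΨ₀G : ∀ (g : GL (Fin 2) (ZMod p)) (z : H1carrier ℤ_[p] p M),
      Ψ₀ (H1carrierRep ℤ_[p] p M g z) =
        coordRep (Kato2004.teichmullerChar p ^ (p - 1 - b)) (Kato2004.teichmullerChar p ^ b) g (Ψ₀ z) :=
    fun g z => frobeniusCoord_apply_rep _ _ _ _ hlam₁B g z
  have hΨ₀T : ∀ (q : ℕ) [NeZero q] (hq : q.Prime) (hqp : q ≠ p) (z : H1carrier ℤ_[p] p M),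
      Ψ₀ (heckeT ℤ_[p] p M hq hqp z) = ((W.LFunction q : ℤ) : ℤ_[p]) • Ψ₀ z := by
    intro q _ hq hqp z
    funext o
    cases o with
    | none => rw [Pi.smul_apply, smul_eq_mul, frobeniusCoord_apply_none, frobeniusCoord_apply_none, hlam₁T]
    | some t =>
      rw [Pi.smul_apply, smul_eq_mul, frobeniusCoord_apply_some, frobeniusCoord_apply_some,
        ← heckeT_H1carrierRep, hlam₁T]
  have hΨ₀K : ∀ z : H1carrier ℤ_[p] p M, spreadPeriod ℤ_[p] p M hpM D.f z = 0 → Ψ₀ z = 0 := by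
    intro z hz
    refine frobeniusCoord_eq_zero_of _ _ _ _ hlam₁B (S := {z | spreadPeriod ℤ_[p] p M hpM D.f z = 0}) ?_ hlam₁K' hz
    intro g w hw
    change spreadPeriod ℤ_[p] p M hpM D.f (H1carrierRep ℤ_[p] p M g w) = 0
    have h := congrArg Subtype.val (spreadElt_H1carrierRep ℤ_[p] p M hpM D.f g w)
    rw [coe_spreadElt] at h
    rw [h]
    change funTranslate p g (spreadPeriod ℤ_[p] p M hpM D.f w) = 0
    rw [show spreadPeriod ℤ_[p] p M hpM D.f w = 0 from hw]
    rfl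
  -- the image lattice
  let Λ' : Subrepresentation (coordRep (Kato2004.teichmullerChar p ^ (p - 1 - b)) (Kato2004.teichmullerChar p ^ b)) :=
    { toSubmodule := LinearMap.range Ψ₀
      apply_mem_toSubmodule := fun g v hv => by
        obtain ⟨z, rfl⟩ := hv
        exact ⟨H1carrierRep ℤ_[p] p M g z, hΨ₀G g z⟩ }
  have hnz : ∃ v ∈ Λ', coordReduce (ZMod p) v ≠ 0 := by
    refine ⟨Ψ₀ z₁, ⟨z₁, rfl⟩, fun h => hz₁ ((hker _).mp ?_)⟩
    have := congr_fun h none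
    rwa [coordReduce_apply, frobeniusCoord_apply_none, Pi.zero_apply] at this
  -- `im Ψ₀ = L`
  have htop : Λ'.toSubmodule = ⊤ := by
    by_contra hne
    have hnt : ∃ w : Option (ZMod p) → ZMod p, ∀ v ∈ Λ', coordReduce (ZMod p) v ≠ w := by
      by_contra hall
      push Not at hall
      exact hne (toSubmodule_eq_top_of_forall_exists_coordReduce_eq_of_jacobson p _ _ hker hjac Λ' hall)
    obtain ⟨π, hπsurj, hπeq⟩ := exists_surjective_symPowTwist_of_reduction_ne p
      (Kato2004.teichmullerChar p ^ (p - 1 - b)) (Kato2004.teichmullerChar p ^ b) hsurj hχne hχ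
      (s := p - 1 - 2 * b) (by omega) Λ' hnz hnt
    let Θ : H1carrier ℤ_[p] p M →ₗ[ℤ_[p]] ↥(MvPolynomial.homogeneousSubmodule (Fin 2) (ZMod p) (2 * b)) :=
      π.comp Ψ₀.rangeRestrict
    have hΘG : ∀ (g : GL (Fin 2) (ZMod p)) (z : H1carrier ℤ_[p] p M),
        Θ (H1carrierRep ℤ_[p] p M g z) =
          symPowTwist (ZMod.castHom (dvd_refl p) (ZMod p))
            (reduceChar (ZMod p) (Kato2004.teichmullerChar p ^ (p - 1 - b))) (2 * b) g (Θ z) := by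
      intro g z
      change π (Ψ₀.rangeRestrict _) = symPowTwist _ _ _ g (π (Ψ₀.rangeRestrict z))
      rw [← hπeq g]
      congr 1
      exact Subtype.ext (hΨ₀G g z)
    have hΘT : ∀ (q : ℕ) [NeZero q] (hq : q.Prime) (hqp : q ≠ p) (z : H1carrier ℤ_[p] p M),
        Θ (heckeT ℤ_[p] p M hq hqp z) = (((W.LFunction q : ℤ) : ZMod p)) • Θ z := by
      intro q _ hq hqp z
      have hsm : Ψ₀.rangeRestrict (heckeT ℤ_[p] p M hq hqp z) = ((W.LFunction q : ℤ) : ℤ_[p]) • Ψ₀.rangeRestrict z :=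
        Subtype.ext (by rw [LinearMap.codRestrict_apply, Submodule.coe_smul, LinearMap.codRestrict_apply, hΨ₀T])
      change π (Ψ₀.rangeRestrict _) = _ • π (Ψ₀.rangeRestrict z)
      rw [hsm, map_smul, ← algebraMap_smul (ZMod p) ((W.LFunction q : ℤ) : ℤ_[p]), map_intCast]
    have h0 : Θ = 0 := hW p M W hN hp11 hadd hirr hGo hV4 Θ hΘG hΘT
    have hsurjΘ : Surjective Θ := hπsurj.comp (LinearMap.surjective_rangeRestrict Ψ₀)
    obtain ⟨x, hx⟩ := hsurjΘ ⟨MvPolynomial.X 0 ^ (2 * b), X_zero_pow_mem (2 * b)⟩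
    rw [h0, LinearMap.zero_apply] at hx
    exact pow_ne_zero (2 * b) (MvPolynomial.X_ne_zero (0 : Fin 2)) (congrArg Subtype.val hx).symm
  -- descend `Ψ₀` to `Λ_Q(f_D) = C / ker(spreadPeriod)`
  have hkerle : LinearMap.ker (spreadPeriod ℤ_[p] p M hpM D.f) ≤ LinearMap.ker Ψ₀ :=
    fun z hz => hΨ₀K z hz
  let Ψ : spreadLattice ℤ_[p] p M hpM D.f →ₗ[ℤ_[p]] (Option (ZMod p) → ℤ_[p]) :=
    ((LinearMap.ker (spreadPeriod ℤ_[p] p M hpM D.f)).liftQ Ψ₀ hkerle).comp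
      (spreadPeriod ℤ_[p] p M hpM D.f).quotKerEquivRange.symm.toLinearMap
  have hΨ : ∀ z, Ψ (spreadElt ℤ_[p] p M hpM D.f z) = Ψ₀ z := by
    intro z
    have hq : (spreadPeriod ℤ_[p] p M hpM D.f).quotKerEquivRange.symm (spreadElt ℤ_[p] p M hpM D.f z) =
        Submodule.Quotient.mk z := by
      rw [LinearEquiv.symm_apply_eq]
      exact Subtype.ext (by rw [LinearMap.quotKerEquivRange_apply_mk, coe_spreadElt])
    change (LinearMap.ker (spreadPeriod ℤ_[p] p M hpM D.f)).liftQ Ψ₀ hkerle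
      ((spreadPeriod ℤ_[p] p M hpM D.f).quotKerEquivRange.symm (spreadElt ℤ_[p] p M hpM D.f z)) = Ψ₀ z
    rw [hq, Submodule.liftQ_apply]
  have hΨeq : IsEquivariantOnSpread ℤ_[p] p M hpM D.f
      (coordRep (Kato2004.teichmullerChar p ^ (p - 1 - b)) (Kato2004.teichmullerChar p ^ b)) Ψ := by
    intro F g
    obtain ⟨z, hz⟩ : ∃ z, spreadElt ℤ_[p] p M hpM D.f z = F := by
      obtain ⟨z, hz⟩ := F.2
      exact ⟨z, Subtype.ext hz⟩
    subst hz
    rw [← spreadElt_H1carrierRep, hΨ, hΨ, hΨ₀G]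
  have hrange : LinearMap.range Ψ = ⊤ := by
    rw [eq_top_iff]
    rintro v -
    have hv : v ∈ Λ'.toSubmodule := by rw [htop]; exact Submodule.mem_top
    obtain ⟨z, rfl⟩ := hv
    exact ⟨spreadElt ℤ_[p] p M hpM D.f z, hΨ z⟩
  refine ⟨b, 0, Ψ, hb, hb2, hΨeq, fun v => ?_, ?_⟩
  · rw [pow_zero, one_smul, hrange]
    exact Submodule.mem_top
  · intro Λ'' hΛ''
    have htop'' : Λ''.toSubmodule = ⊤ := by rw [hΛ'', hrange]
    intro N hN hN0
    exact exists_injective_symPowTwist_of_toSubmodule_eq_top p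
      (Kato2004.teichmullerChar p ^ (p - 1 - b)) (Kato2004.teichmullerChar p ^ b) hker hsurj hχne hχ (by omega)
      Λ'' htop'' N hN hN0

/-- **K from modularity, a nonzero Borel eigenfunctional (I1‴) and the Ash–Stevens weight exclusion (W‴).**  Conclusion = the
route decl `TwistedPeriodLatticeSaturation` VERBATIM; BSD is not proved by this; K is proved CONDITIONALLY on the three named
hypotheses. [cite: EdixhovenManin1991, §4] [cite: SerreLinearRepresentations1977, §7.2 Prop. 21] -/
theorem twistedPeriodLatticeSaturation_of_borel_of_noEtaleWeightEigenQuotient (hnf : exists_isNewformOf)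
    (hB : NonzeroBorelEigenfunctional) (hW : NoEtaleWeightEigenQuotient) :
    Summit.BirchSwinnertonDyer.BirchSwinnertonDyer.Theses.TeichmullerTwistDescent.TwistedPeriodLatticeSaturation :=
  twistedPeriodLatticeSaturation_of_integralTameTypeCarrierFunctional hnf
    (integralTameTypeCarrierFunctional_of_borel_of_noEtaleWeightEigenQuotient hB hW)

/-! ### Appended: (I1″) ⟹ (I1‴) — the identity-coset coordinate of the rational functional -/

/-- The identity-coset coordinate of the Bruhat model is a `(B, χ₁ ⊗ χ₂)`-eigenfunctional:
`(coordRep χ₁ χ₂ b v)(none) = χ(b) · v(none)` for `b` in the Borel subgroup. [cite: Bump1997, §4.1 Eq. (1.6)–(1.7)] -/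
theorem coordRep_borel_apply_none {F : Type} [Field F] [DecidableEq F] {R : Type} [CommRing R] (χ₁ χ₂ : Fˣ →* Rˣ)
    (b : borel F) (v : Option F → R) :
    coordRep χ₁ χ₂ (b : GL (Fin 2) F) v none = (borelCharacter F χ₁ χ₂ b : R) * v none := by
  rw [coordRep_apply, bruhatEval_none, principalSeriesRep_apply_coe, one_mul, ← mul_one (b : GL (Fin 2) F),
    apply_borel_mul, ← bruhatEval_none, bruhatEval_bruhatLift]

/-- **(I1″) ⟹ (I1‴)**: the rational functional of finite index yields a nonzero Borel eigenfunctional — the identity-coset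
coordinate of `Ψ ∘ spreadPeriod`.  So the input (I1‴) of `KOfBorelEigenfunctional` is implied by the input (I1″) of
`KOfWeightExclusion` (and, with (W‴), conversely implies `IntegralTameTypeCarrierFunctional`, which trivially implies (I1″)):
replacing (I1″) by (I1‴) loses nothing.  BSD is not proved by this. [cite: SerreLinearRepresentations1977, §7.2 Prop. 21]
[cite: AshStevens1986, §1 (1.2)–(1.3)] -/
theorem nonzeroBorelEigenfunctional_of_rational (hrat : RationalTameTypeCarrierFunctional) : NonzeroBorelEigenfunctional := by
  intro p M _ _ _ hpM _ _ W _ _ hN D hp11 hadd hirr hGo hV4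
  obtain ⟨hb, hb2, m, Ψ, hΨ, hm⟩ := hrat p M hpM W hN D hp11 hadd hirr hGo hV4
  set b := tameExponent p W with hbdef
  -- `λ z := Ψ(Π z)(1)`
  let ev : (Option (ZMod p) → ℤ_[p]) →ₗ[ℤ_[p]] ℤ_[p] := LinearMap.proj none
  let lam : H1carrier ℤ_[p] p M →ₗ[ℤ_[p]] ℤ_[p] :=
    ev.comp (Ψ.comp (LinearMap.rangeRestrict (spreadPeriod ℤ_[p] p M hpM D.f)))
  have hlam : ∀ z, lam z = Ψ (spreadElt ℤ_[p] p M hpM D.f z) none := fun z => rfl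
  refine ⟨hb, hb2, lam, ?_, ?_, ?_⟩
  · -- nonzero: `pᵐ · δ_none ∈ im Ψ`
    intro h0
    obtain ⟨F, hF⟩ := hm (fun o => if o = none then 1 else 0)
    obtain ⟨z, hz⟩ : ∃ z, spreadElt ℤ_[p] p M hpM D.f z = F := by
      obtain ⟨z, hz⟩ := F.2
      exact ⟨z, Subtype.ext hz⟩
    have h1 : lam z = (p : ℤ_[p]) ^ m := by
      rw [hlam, hz, hF, Pi.smul_apply, smul_eq_mul]
      simp
    rw [h0, LinearMap.zero_apply] at h1
    exact pow_ne_zero m (NeZero.ne (p : ℤ_[p])) h1.symm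
  · intro β z
    rw [hlam, hlam, spreadElt_H1carrierRep, hΨ _ (β : GL (Fin 2) (ZMod p)), coordRep_borel_apply_none]
  · intro z hz
    have : spreadElt ℤ_[p] p M hpM D.f z = 0 := Subtype.ext (by rw [coe_spreadElt, hz]; rfl)
    rw [hlam, this, map_zero, Pi.zero_apply]

end KOfBorelEigenfunctional

end Summit.BirchSwinnertonDyer.BirchSwinnertonDyer.Theorems.TeichmullerTwistDescent
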